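import Summits.Ventures.CertifiedQuantumChemistry.Certificates.H8RingSto3gR0707FastVector
import HarnessLib

/-!
# Ventures/CertifiedQuantumChemistry — Certificates/H8RingSto3gR0707FastRows4.lean: row chunks part 4 of 5 of the kernel
# discharge of `cert_h8ringsto3gr0707_fci_r103_upper` (H₈ ring STO-3G, sector `(4,4)`)

HONEST FRAMING (verbatim): certified bounds for a stated model Hamiltonian in a stated basis; not a
claim about the real molecule beyond that model.

var-2 (gen 16), zero compute. PART 4 of 5 (part 1 = `…FastRows.lean` with the table agreement and the mask checks;
the discharge = `…FastUpper.lean`). Machinery: `Rows/OccupationBitmasks.lean`,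
`Rows/OccupationVectorMasks.lean`, `Rows/SlaterCondonFast.lean`, `Rows/CIFastRows.lean` (var-2 g16); data:
`Certificates/H8RingSto3gR0707FastTables.lean` / `…FastVector.lean`. Contents: the row inequalities `fastRow i ≤ R_i` of the upper-triangle Rayleigh
numerator (`Rows/CIFastRows.lean`) for the chunks `[521,573)`, `[573,624)`, `[624,673)`, `[673,727)`, `[727,789)`, each ONE `decide +kernel`
(≈ 96 s of kernel time on the farm in this file). Decided facts only; no claim node; 0 sorry.
-/

set_option linter.style.longLine false

namespace Summit.Ventures.CertifiedQuantumChemistry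

namespace Certificates

set_option maxHeartbeats 100000000 in
/-- Rows `521 ≤ i < 573`: `fastRow i ≤ R_i` (in fact `=`); ONE `decide +kernel` (cost units 51998). -/
theorem h8f_rows_521_573 : ∀ i < 573, 521 ≤ i → h8fT.fastRow h8fMask h8fCoef 1196 i ≤ h8fR i := by
  decide +kernel

set_option maxHeartbeats 100000000 in
/-- Rows `573 ≤ i < 624`: `fastRow i ≤ R_i` (in fact `=`); ONE `decide +kernel` (cost units 52123). -/
theorem h8f_rows_573_624 : ∀ i < 624, 573 ≤ i → h8fT.fastRow h8fMask h8fCoef 1196 i ≤ h8fR i := by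
  decide +kernel

set_option maxHeartbeats 100000000 in
/-- Rows `624 ≤ i < 673`: `fastRow i ≤ R_i` (in fact `=`); ONE `decide +kernel` (cost units 51490). -/
theorem h8f_rows_624_673 : ∀ i < 673, 624 ≤ i → h8fT.fastRow h8fMask h8fCoef 1196 i ≤ h8fR i := by
  decide +kernel

set_option maxHeartbeats 100000000 in
/-- Rows `673 ≤ i < 727`: `fastRow i ≤ R_i` (in fact `=`); ONE `decide +kernel` (cost units 51798). -/
theorem h8f_rows_673_727 : ∀ i < 727, 673 ≤ i → h8fT.fastRow h8fMask h8fCoef 1196 i ≤ h8fR i := by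
  decide +kernel

set_option maxHeartbeats 100000000 in
/-- Rows `727 ≤ i < 789`: `fastRow i ≤ R_i` (in fact `=`); ONE `decide +kernel` (cost units 51790). -/
theorem h8f_rows_727_789 : ∀ i < 789, 727 ≤ i → h8fT.fastRow h8fMask h8fCoef 1196 i ≤ h8fR i := by
  decide +kernel

end Certificates

end Summit.Ventures.CertifiedQuantumChemistry
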